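/-
Copyright (c) 2026 the pub-hodgecm-mathlib formalisation cell (harness21).  Prover seat hodgecm-mathlib-K2E1-p12 (g6), Track B ∕ K2-LIT, h413 = `stmt-HodgeConjecture-24833`,
R90-TF section S8 «ContSpec-n½», ESTATE T (S8 dealer R90-CS-plan (g3) S8-R199 J-S8-ADM′, S8-R204 J-S8-T1, S8-R208 (1) J-S8-T2 «§5 splitting»): the PURE-TYPE SPLITTING of an arch-finite
τ-admissible section — every `K_max`-IRREDUCIBLE finite-dimensional stable space of pair-sections is `K_∞`-ISOTYPIC (lies in ONE ★ (3′) `τ`-part `V^τ`, `τ` irreducible), and an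
arch-finite section at a normal τ-level is a FINITE SUM of sections lying in such spaces (Weyl's unitarian trick on `K_max`, ★ β2 p864185).
-/
import Summits.HodgeConjecture.HodgeConjecture.Theorems.R90S8ResGMidAtomTauLawsKMaxU3       -- ★ p864292 (this seat) LAWS file 2: `finiteDimensional_span_comp_subtype_kMax_…`, `rightTranslation_mem_span_kMaxTranslates`, `span_kMaxTranslates_le_chiSectionSpacePair_bot`, `mem_span_kMaxTranslates_self`, `finPart_mem_finAdelicIntegralLevel`; brings ★ file 1 p864264 (`rightTranslation_mul_apply`), ★ τ-DEFS p864157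
import Summits.HodgeConjecture.HodgeConjecture.Theorems.R90S8ResGMidAtomKFiniteExchangeU3    -- ★ β2 p864185 (R90-C133-p02): `le_of_irreducibles_le_of_invariant_form`, `exists_invariant_definite_form_kMax`, `continuous_of_mem_span_rightTranslation`; brings ★ (3′) p863637 `chiSectionPairSubrep`∕`chiSectionSpacePairKType`, ★ `isIrreducible_of_equiv`, ★ `Representation.homRangeSum` API, ★ GKModulesProofs
import Mathlib.LinearAlgebra.DFinsupp                                                        -- Mathlib `Submodule.mem_iSup_finset_iff_exists_sum`
import Mathlib.LinearAlgebra.Finsupp.Span                                                    -- Mathlib `Submodule.mem_iSup_iff_exists_finset`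
import HarnessLib

/-!
# R90-TF · S8 «ContSpec-n½» — `R90S8ResGMidAtomTauPureSplitU3`: ESTATE T §5 — PURITY OF `K_max`-IRREDUCIBLES AND THE PURE-TYPE SPLITTING OF ARCH-FINITE τ-ADMISSIBLE SECTIONS

Cell `hodgecm-mathlib`, crux H413 (`stmt-HodgeConjecture-24833`, lane `--supports … --as helper`), route of record `HCCMUnconditional`; R90-TF section S8, the T-estate («K-finite
generator package», S8-R199∕R204∕R208).  THEOREMS ONLY (no `def`, no `instance`, no `notation`, no named-fact hypothesis, no `sorry`; default heartbeats); count-neutral; CLOSES NO SOCKET.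

WHY (S8-R208 (1) J-S8-T2 + K2E1-p11 (g5)'s T-FILE 2 census (2)∕(3) + this seat's finding F-EIG 2026-09-05T01:51Z).  The K-finite EXPORTS of a τ-admissible generator are paid PER PURE
`K_∞`-TYPE: the ★ 12d-I ∕ 12d-C one-scalar mechanism («a `K_∞`-central `h_∞ ⊗ 𝟙_U` acts on the flat-section slices by ONE scalar») ports to a `K_∞`-type `τ` through multiplicity one
(K2E1-p14's (α)), so a merely `K_∞`-FINITE section must first be SPLIT into pieces of pure type.  «Pure type» is ★ VOCABULARY: ★ (3′) `chiSectionSpacePairKType χ₁ χ₂ K′ ω ιK hcomm τ`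
= the `τ`-part `V^τ` (sum of the images of the `K`-equivariant maps `τ → V`; projector-free) — here at `K := ↥archMaximalCompact` (★ τ-defs, `ι(K_∞) ≤ G(𝔸)`), `ιK := subtype`, and `τ` an
IRREDUCIBLE finite-dimensional `Representation ℂ ↥archMaximalCompact W` (a bound variable; no `K̂`, no Peter–Weyl, no Haar measure on `K_∞`).  No new definition is introduced.

THE MATHEMATICS ([BrockerTomDieck1985, II (1.9), (4.14)]; [WallachRRG1, §1.4.6–1.4.7, §3.3.1]; [MoeglinWaldspurger1995, I.2.17]; [BorelJacquet1979, §4.1]).  `K_max = ι(K_∞)·ι_f(G(𝒪̂)_f)` with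
COMMUTING factors (★ `archToAdelic_mul_finAdelicToAdelic`, ★ `commute_archToAdelic_finAdelicToAdelic`).
* §5.0 Bookkeeping: `archMaximalCompact_le_kMax`; `commute_tauLevel_archMaximalCompact` (the `hcomm` of ★ (3′) at `K′ = tauLevel U₀`); `finAdelicToAdelic_mem_kMax`; `rightTranslation_arch_fin_comm`;
  `isArchFinite_of_mem_of_finiteDimensional` (a member of a finite-dimensional `ι(K_∞)`-stable space is arch-finite); and — for a τ-level `U₀` NORMALISED by `G(𝒪̂)_f` (`hN`; the levels of
  record `K(𝔫)_f` qualify) — `rightTranslation_kMax_mem_chiSectionSpacePair_tauLevel` ∕ `span_kMaxTranslates_le_chiSectionSpacePair_tauLevel`: the `K_max`-translates of a section at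
  `(tauLevel U₀, 1)` STAY at that level (`g·ι_f u·ι(a)ι_f(c) = g·ι(a)ι_f(c)·ι_f(c⁻¹uc)`).
* §5a **PURITY — `le_chiSectionSpacePairKType_of_kMax_irreducible`**: an irreducible finite-dimensional `K_max`-stable `U ≤ V(χ₁, χ₂; K′, ω)` (any level commuting with `ι(K_∞)`) lies in
  `V(χ₁, χ₂; K′, ω)^τ` for ONE irreducible f.d. `τ` of `K_∞` — realised on a minimal `K_∞`-stable `W₀ ≤ U` (★ `exists_minimal_stable_submodule`, ★ `isIrreducible_of_intertwiningMap_injective`):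
  the `τ`-part `U(τ) := homRangeSum (r|_U ∘ K_∞) τ` contains `W₀ ≠ 0`, is `K_∞`-stable (★ `apply_mem_homRangeSum_of_mem`) AND `ι_f(G(𝒪̂)_f)`-stable (each `r(ι_f c)|_U` is a `K_∞`-INTERTWINER
  by the commutation, ★ `map_homRangeSum_le`), hence a non-zero `K_max`-subrepresentation of the irreducible `U`, hence all of `U`; push along `U ↪ V` (★ `map_homRangeSum_le`, ★ (3′) L2).
  («An irreducible representation of `K_∞ × K_f⁰` is `K_∞`-isotypic.»)
* §5b **SPLITTING — `exists_finset_sum_mem_kMax_irreducible`** (block characters `(ξ.bcη⁻¹ξ.bcψ⁻¹μω, ξ.ψ)` of ★ D1, as in ★ β2): an arch-finite continuous `φ ∈ V(…; tauLevel U₀, 1)`,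
  `IsTauLevel U₀`, is a FINITE SUM `φ = Σᵢ cᵢ` with `cᵢ ∈ Uᵢ ≤ S_φ := span r(K_max)φ`, each `Uᵢ` irreducible f.d. `K_max`-stable: `S_φ` is finite-dimensional (★ laws file 2), stable, made of
  continuous level-free pair-sections, so ★ β2's unitarian trick `exists_invariant_definite_form_kMax` + complete reducibility `le_of_irreducibles_le_of_invariant_form` put `φ` in the `⨆`
  of the irreducible stable subspaces; Mathlib `Submodule.mem_iSup_iff_exists_finset` + `mem_iSup_finset_iff_exists_sum` extract the finite sum; irreducibility is transported to
  `Uᵢ ↪ (G(𝔸) → ℂ)` along `Submodule.equivSubtypeMap` (★ `isIrreducible_of_equiv`, β2's pattern).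
* §5c **HEAD — `exists_finset_sum_mem_chiSectionSpacePairKType_of_isArchFinite`** (§5b ∘ §5a, normal τ-level `hN`): every arch-finite τ-admissible section is a finite sum of CONTINUOUS,
  ARCH-FINITE sections `cᵢ ∈ V(…; tauLevel U₀, 1)^{τᵢ}`, `τᵢ` irreducible f.d. `K_∞`-types, `cᵢ ∈ span r(K_max)φ` — the currency of the 12d-C_τ port; and the LEVEL-FREE twin
  **`exists_finset_sum_mem_chiSectionSpacePairKType_bot_of_isArchFinite`** (no `hN`: purity read in `V(…; ⊥, 1)^{τᵢ}`, `hcomm` vacuous ★ `commute_of_mem_bot`).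
* §5d **THE CONSUMER PACKAGE — `exists_finset_sum_pure_blocks_of_isArchFinite`** (RULING J-S8-T2′): for a continuous BOUNDED arch-finite τ-admissible `φ` at a normal τ-level, the pieces come WITH
  THEIR BLOCKS `Vᵢ ∋ cᵢ` carrying K2E1-p11's head binders BY SHAPE — `FiniteDimensional`, `hVK : ∀ k ∈ K_max, ∀ ψ ∈ Vᵢ, (fun x => ψ (x * k)) ∈ Vᵢ`, `hVχ` (pair-sections), `hVc` (continuous),
  `hVM` (bounded, `exists_bound_of_mem_span_kMaxTranslates`) — plus the level `(tauLevel U₀, 1)`, `K_max`-irreducibility and the PURE `K_∞`-TYPE `Vᵢ ≤ V(…)^{τᵢ}`.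
NOT CLAIMED: any scalar action of `G_∞`-convolutions `R_{h_∞}` (finding F-EIG: `R_h` does not preserve the `K_∞`-span; the one-scalar clause is the OUTPUT of the 12d-C_τ port from
purity + (α)); multiplicity one (α) itself (K2E1-p14); the K-finite exports (K2E1-p11).
HONEST LABEL: HC_CM is proved only modulo the 7 printed citations (2 remaining named inputs: hLiu418 = `stmt-HodgeConjecture-24832`, h413 = `stmt-HodgeConjecture-24833`) until rung 0
closes; splitting pays no socket; ESTATE T stays L until (b′)+(α)+ports+head are ★; REL ≠ ★ ≠ WRITTEN ≠ BUILT; count-neutral.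

## References
* [BrockerTomDieck1985] T. Bröcker, T. tom Dieck, *Representations of Compact Lie Groups*, GTM 98 (1985), II (1.9) (complete reducibility), II (4.14)–(4.15) (irreducibles of a product of
  compact groups are tensor products, hence isotypic for each factor).
* [WallachRRG1] N. R. Wallach, *Real Reductive Groups I* (1988), §1.4.6–1.4.7 (`V(γ)`), §3.3.1 (`K`-finite vectors).
* [MoeglinWaldspurger1995] C. Mœglin, J.-L. Waldspurger, *Spectral Decomposition and Eisenstein Series* (1995), I.2.17 (`K`-finite induced sections).
* [BorelJacquet1979] A. Borel, H. Jacquet, *Automorphic forms and automorphic representations*, Proc. Symp. Pure Math. 33.1 (1979), §4.1 (`K = K_∞·K_f`).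
-/

set_option autoImplicit false
set_option linter.dupNamespace false  -- the mandated namespace `…HodgeConjecture.HodgeConjecture.R90.S8` (LEAD #1 L1) repeats the summit's segment

noncomputable section

open MeasureTheory Measure Set Filter Topology NumberField ContRepresentation
open Literature.NumberTheory Literature.NumberTheory.Automorphic Literature.NumberTheory.Automorphic.UnitaryGroup Literature.NumberTheory.GaloisRepresentations AdelicGroupData
open Literature.NumberTheory.Automorphic.Arthur2013.Leaves.TECR Literature.NumberTheory.Rogawski1990
open Summit.HodgeConjecture.HodgeConjecture.Cruxes.H413.K2E1BorelEisensteinU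
open Summit.HodgeConjecture.HodgeConjecture.Cruxes.H413.K2E1CharacterEisensteinU3PairDefs
open Summit.HodgeConjecture.HodgeConjecture.Cruxes.H413.K2E1ChiSectionSpaceU3PairDefs
open scoped ENNReal NNReal

namespace Summit.HodgeConjecture.HodgeConjecture.R90.S8

variable (L : Type) [Field L] [NumberField L] [IsCMField L]

/-! ## §5.0 Bookkeeping: `ι(K_∞) ≤ K_max`, the commutation of `ι(K_∞)` with `ι_f(·)`, and the level under `K_max`-translation at a NORMAL τ-level -/

/-- `ι(K_∞) ≤ K_max` (the first clause of ★ `archMaximalCompact`). [cite: BorelJacquet1979, §4.1] -/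
theorem archMaximalCompact_le_kMax : archMaximalCompact L ≤ ((standardMaximalCompactGL 3 L).comap (adelicVal (↥(maximalRealSubfield L)) L (IsCMField.complexConj L) 3 ((StdForm.antidiagonal 3).over L)) : Subgroup (quasiSplit (↥(maximalRealSubfield L)) L (IsCMField.complexConj L) 3).Adelic) := fun _ hk => hk.1

/-- **The `hcomm` of ★ (3′) at a τ-level**: every element of `tauLevel U₀ = ι_f(U₀)` commutes with every element of `ι(K_∞)` (★ `commute_archToAdelic_finAdelicToAdelic`). [cite: BorelJacquet1979, §4.1] -/
theorem commute_tauLevel_archMaximalCompact (U₀ : Subgroup ↥(finAdelic (↥(maximalRealSubfield L)) L (IsCMField.complexConj L) 3 ((StdForm.antidiagonal 3).over L))) :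
    ∀ k : ↥(archMaximalCompact L), ∀ k' ∈ tauLevel L U₀, k' * (k : (quasiSplit (↥(maximalRealSubfield L)) L (IsCMField.complexConj L) 3).Adelic) = (k : (quasiSplit (↥(maximalRealSubfield L)) L (IsCMField.complexConj L) 3).Adelic) * k' := by
  rintro ⟨_, -, a, rfl⟩ k' hk'
  obtain ⟨b, -, rfl⟩ := (mem_tauLevel_iff L U₀ k').1 hk'
  exact (commute_archToAdelic_finAdelicToAdelic _ _ _ _ _ a b).eq.symm

/-- `ι_f(c) ∈ K_max` for `c ∈ G(𝒪̂)_f` (★ `adelicVal_finAdelicToAdelic_mem_standardMaximalCompactGL`). [cite: BorelJacquet1979, §4.1] -/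
theorem finAdelicToAdelic_mem_kMax {c : ↥(finAdelic (↥(maximalRealSubfield L)) L (IsCMField.complexConj L) 3 ((StdForm.antidiagonal 3).over L))} (hc : c ∈ (finAdelicIntegralLevel (↥(maximalRealSubfield L)) L (IsCMField.complexConj L) 3 ((StdForm.antidiagonal 3).over L))) : (finAdelicToAdelic (↥(maximalRealSubfield L)) L (IsCMField.complexConj L) 3 ((StdForm.antidiagonal 3).over L)) c ∈ ((standardMaximalCompactGL 3 L).comap (adelicVal (↥(maximalRealSubfield L)) L (IsCMField.complexConj L) 3 ((StdForm.antidiagonal 3).over L)) : Subgroup (quasiSplit (↥(maximalRealSubfield L)) L (IsCMField.complexConj L) 3).Adelic) :=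
  Subgroup.mem_comap.2 (adelicVal_finAdelicToAdelic_mem_standardMaximalCompactGL L hc)

/-- `r(ι a)` and `r(ι_f b)` commute on functions. [cite: BorelJacquet1979, §4.1] -/
theorem rightTranslation_arch_fin_comm (a : ↥(arch (↥(maximalRealSubfield L)) L (IsCMField.complexConj L) 3 ((StdForm.antidiagonal 3).over L))) (b : ↥(finAdelic (↥(maximalRealSubfield L)) L (IsCMField.complexConj L) 3 ((StdForm.antidiagonal 3).over L))) (φ : (quasiSplit (↥(maximalRealSubfield L)) L (IsCMField.complexConj L) 3).Adelic → ℂ) :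
    (rightTranslation (quasiSplit (↥(maximalRealSubfield L)) L (IsCMField.complexConj L) 3)) ((archToAdelic (↥(maximalRealSubfield L)) L (IsCMField.complexConj L) 3 ((StdForm.antidiagonal 3).over L)) a) ((rightTranslation (quasiSplit (↥(maximalRealSubfield L)) L (IsCMField.complexConj L) 3)) ((finAdelicToAdelic (↥(maximalRealSubfield L)) L (IsCMField.complexConj L) 3 ((StdForm.antidiagonal 3).over L)) b) φ) = (rightTranslation (quasiSplit (↥(maximalRealSubfield L)) L (IsCMField.complexConj L) 3)) ((finAdelicToAdelic (↥(maximalRealSubfield L)) L (IsCMField.complexConj L) 3 ((StdForm.antidiagonal 3).over L)) b) ((rightTranslation (quasiSplit (↥(maximalRealSubfield L)) L (IsCMField.complexConj L) 3)) ((archToAdelic (↥(maximalRealSubfield L)) L (IsCMField.complexConj L) 3 ((StdForm.antidiagonal 3).over L)) a) φ) := by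
  rw [← rightTranslation_mul_apply, ← rightTranslation_mul_apply, (commute_archToAdelic_finAdelicToAdelic _ _ _ _ _ a b).eq]

/-- **A member of a finite-dimensional `ι(K_∞)`-stable space of functions is arch-finite** (its `K_∞`-translate span lies in that space). [cite: WallachRRG1, §3.3.1] -/
theorem isArchFinite_of_mem_of_finiteDimensional {U : Submodule ℂ ((quasiSplit (↥(maximalRealSubfield L)) L (IsCMField.complexConj L) 3).Adelic → ℂ)} [FiniteDimensional ℂ ↥U]
    (hU : ∀ k : ↥(archMaximalCompact L), ∀ ψ ∈ U, ((rightTranslation (quasiSplit (↥(maximalRealSubfield L)) L (IsCMField.complexConj L) 3)).comp (archMaximalCompact L).subtype) k ψ ∈ U) {ψ : (quasiSplit (↥(maximalRealSubfield L)) L (IsCMField.complexConj L) 3).Adelic → ℂ} (hψ : ψ ∈ U) : IsArchFinite L ψ := by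
  rw [isArchFinite_iff, archTranslateSpan_def]
  refine Submodule.finiteDimensional_of_le (S₂ := U) (Submodule.span_le.2 ?_)
  rintro _ ⟨k, rfl⟩
  exact hU k ψ hψ

variable {χ₁ : HeckeCharacter L} {χ₂ : ↥(TorusDict.torus (IsCMField.complexConj L)) →ₜ* ℂˣ}
  {U₀ : Subgroup ↥(finAdelic (↥(maximalRealSubfield L)) L (IsCMField.complexConj L) 3 ((StdForm.antidiagonal 3).over L))}

/-- **`K_max`-TRANSLATES STAY AT A NORMAL τ-LEVEL**: if `U₀ ≤ G(𝒪̂)_f` is normalised by `G(𝒪̂)_f` (`hN`) then for `φ ∈ V(χ₁, χ₂; tauLevel U₀, 1)` and `k ∈ K_max`, `r(k)φ ∈ V(χ₁, χ₂; tauLevel U₀, 1)`: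
`k = ι(a)·ι_f(c)` and `g·ι_f(u)·k = g·k·ι_f(c⁻¹uc)` with `c⁻¹uc ∈ U₀`. [cite: BorelJacquet1979, §4.1] [cite: MoeglinWaldspurger1995, I.2.17] -/
theorem rightTranslation_kMax_mem_chiSectionSpacePair_tauLevel (hN : ∀ b ∈ (finAdelicIntegralLevel (↥(maximalRealSubfield L)) L (IsCMField.complexConj L) 3 ((StdForm.antidiagonal 3).over L)), ∀ u ∈ U₀, b * u * b⁻¹ ∈ U₀) (k : ↥((standardMaximalCompactGL 3 L).comap (adelicVal (↥(maximalRealSubfield L)) L (IsCMField.complexConj L) 3 ((StdForm.antidiagonal 3).over L)) : Subgroup (quasiSplit (↥(maximalRealSubfield L)) L (IsCMField.complexConj L) 3).Adelic))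
    {φ : (quasiSplit (↥(maximalRealSubfield L)) L (IsCMField.complexConj L) 3).Adelic → ℂ} (hφ : φ ∈ chiSectionSpacePair χ₁ χ₂ (tauLevel L U₀) ((1 : ↥(tauLevel L U₀) →* ℂ) : ↥(tauLevel L U₀) → ℂ)) :
    (rightTranslation (quasiSplit (↥(maximalRealSubfield L)) L (IsCMField.complexConj L) 3)) (k : (quasiSplit (↥(maximalRealSubfield L)) L (IsCMField.complexConj L) 3).Adelic) φ ∈ chiSectionSpacePair χ₁ χ₂ (tauLevel L U₀) ((1 : ↥(tauLevel L U₀) →* ℂ) : ↥(tauLevel L U₀) → ℂ) := by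
  refine mem_chiSectionSpacePair (fun b hb g => ?_) fun g k' => ?_
  · rw [rightTranslation_apply, rightTranslation_apply, mul_assoc]
    exact isChiSectionPair_of_mem hφ b hb _
  · obtain ⟨u, hu, hk'⟩ := (mem_tauLevel_iff L U₀ (k' : (quasiSplit (↥(maximalRealSubfield L)) L (IsCMField.complexConj L) 3).Adelic)).1 k'.2
    obtain ⟨a, c, hcK, hk_eq⟩ : ∃ (a : ↥(arch (↥(maximalRealSubfield L)) L (IsCMField.complexConj L) 3 ((StdForm.antidiagonal 3).over L))) (c : ↥(finAdelic (↥(maximalRealSubfield L)) L (IsCMField.complexConj L) 3 ((StdForm.antidiagonal 3).over L))), c ∈ (finAdelicIntegralLevel (↥(maximalRealSubfield L)) L (IsCMField.complexConj L) 3 ((StdForm.antidiagonal 3).over L)) ∧ (k : (quasiSplit (↥(maximalRealSubfield L)) L (IsCMField.complexConj L) 3).Adelic) = (archToAdelic (↥(maximalRealSubfield L)) L (IsCMField.complexConj L) 3 ((StdForm.antidiagonal 3).over L)) a * (finAdelicToAdelic (↥(maximalRealSubfield L)) L (IsCMField.complexConj L) 3 ((StdForm.antidiagonal 3).over L)) c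 :=
      ⟨_, _, finPart_mem_finAdelicIntegralLevel L k.2, (archToAdelic_mul_finAdelicToAdelic _ _ _ _ _ _).symm⟩
    have hv : c⁻¹ * u * c ∈ U₀ := by simpa only [inv_inv] using hN c⁻¹ (inv_mem hcK) u hu
    have key : g * (k' : (quasiSplit (↥(maximalRealSubfield L)) L (IsCMField.complexConj L) 3).Adelic) * (k : (quasiSplit (↥(maximalRealSubfield L)) L (IsCMField.complexConj L) 3).Adelic) = g * (k : (quasiSplit (↥(maximalRealSubfield L)) L (IsCMField.complexConj L) 3).Adelic) * (finAdelicToAdelic (↥(maximalRealSubfield L)) L (IsCMField.complexConj L) 3 ((StdForm.antidiagonal 3).over L)) (c⁻¹ * u * c) := by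
      rw [← hk', hk_eq, map_mul, map_mul, map_inv]
      calc g * (finAdelicToAdelic (↥(maximalRealSubfield L)) L (IsCMField.complexConj L) 3 ((StdForm.antidiagonal 3).over L)) u * ((archToAdelic (↥(maximalRealSubfield L)) L (IsCMField.complexConj L) 3 ((StdForm.antidiagonal 3).over L)) a * (finAdelicToAdelic (↥(maximalRealSubfield L)) L (IsCMField.complexConj L) 3 ((StdForm.antidiagonal 3).over L)) c)
          = g * ((finAdelicToAdelic (↥(maximalRealSubfield L)) L (IsCMField.complexConj L) 3 ((StdForm.antidiagonal 3).over L)) u * (archToAdelic (↥(maximalRealSubfield L)) L (IsCMField.complexConj L) 3 ((StdForm.antidiagonal 3).over L)) a) * (finAdelicToAdelic (↥(maximalRealSubfield L)) L (IsCMField.complexConj L) 3 ((StdForm.antidiagonal 3).over L)) c := by simp only [mul_assoc]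
        _ = g * ((archToAdelic (↥(maximalRealSubfield L)) L (IsCMField.complexConj L) 3 ((StdForm.antidiagonal 3).over L)) a * (finAdelicToAdelic (↥(maximalRealSubfield L)) L (IsCMField.complexConj L) 3 ((StdForm.antidiagonal 3).over L)) u) * (finAdelicToAdelic (↥(maximalRealSubfield L)) L (IsCMField.complexConj L) 3 ((StdForm.antidiagonal 3).over L)) c := by rw [(commute_archToAdelic_finAdelicToAdelic _ _ _ _ _ a u).eq]
        _ = g * ((archToAdelic (↥(maximalRealSubfield L)) L (IsCMField.complexConj L) 3 ((StdForm.antidiagonal 3).over L)) a * (finAdelicToAdelic (↥(maximalRealSubfield L)) L (IsCMField.complexConj L) 3 ((StdForm.antidiagonal 3).over L)) c) * (((finAdelicToAdelic (↥(maximalRealSubfield L)) L (IsCMField.complexConj L) 3 ((StdForm.antidiagonal 3).over L)) c)⁻¹ * (finAdelicToAdelic (↥(maximalRealSubfield L)) L (IsCMField.complexConj L) 3 ((StdForm.antidiagonal 3).over L)) u * (finAdelicToAdelic (↥(maximalRealSubfield L)) L (IsCMField.complexConj L) 3 ((StdForm.antidiagonal 3).over L)) c) := by group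
    have h2 := apply_mul_of_mem hφ (g * (k : (quasiSplit (↥(maximalRealSubfield L)) L (IsCMField.complexConj L) 3).Adelic)) ⟨_, finAdelicToAdelic_mem_tauLevel L hv⟩
    rw [MonoidHom.one_apply, one_mul] at h2
    rw [MonoidHom.one_apply, one_mul, rightTranslation_apply, rightTranslation_apply, key]
    exact h2

/-- **`span r(K_max)φ ≤ V(χ₁, χ₂; tauLevel U₀, 1)`** at a normal τ-level (previous lemma + `span_le`), in the `K_max`-action spelling of ★ β2. [cite: MoeglinWaldspurger1995, I.2.17] -/
theorem span_kMaxTranslates_le_chiSectionSpacePair_tauLevel (hN : ∀ b ∈ (finAdelicIntegralLevel (↥(maximalRealSubfield L)) L (IsCMField.complexConj L) 3 ((StdForm.antidiagonal 3).over L)), ∀ u ∈ U₀, b * u * b⁻¹ ∈ U₀)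
    {φ : (quasiSplit (↥(maximalRealSubfield L)) L (IsCMField.complexConj L) 3).Adelic → ℂ} (hφ : φ ∈ chiSectionSpacePair χ₁ χ₂ (tauLevel L U₀) ((1 : ↥(tauLevel L U₀) →* ℂ) : ↥(tauLevel L U₀) → ℂ)) :
    (Submodule.span ℂ (Set.range fun k : ↥((standardMaximalCompactGL 3 L).comap (adelicVal (↥(maximalRealSubfield L)) L (IsCMField.complexConj L) 3 ((StdForm.antidiagonal 3).over L)) : Subgroup (quasiSplit (↥(maximalRealSubfield L)) L (IsCMField.complexConj L) 3).Adelic) => ((rightTranslation (quasiSplit (↥(maximalRealSubfield L)) L (IsCMField.complexConj L) 3)).comp ((standardMaximalCompactGL 3 L).comap (adelicVal (↥(maximalRealSubfield L)) L (IsCMField.complexConj L) 3 ((StdForm.antidiagonal 3).over L)) : Subgroup (quasiSplit (↥(maximalRealSubfield L)) L (IsCMField.complexConj L) 3).Adelic).subtype) k φ)) ≤ chiSectionSpacePair χ₁ χ₂ (tauLevel L U₀) ((1 : ↥(tauLevel L U₀) →* ℂ) : ↥(tauLevel L U₀) → ℂ) := by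
  refine Submodule.span_le.2 ?_
  rintro _ ⟨k, rfl⟩
  exact rightTranslation_kMax_mem_chiSectionSpacePair_tauLevel L hN k hφ

/-- **Members of the `K_max`-translate span of a BOUNDED function are bounded** (translates keep the bound; finite sums and scalar multiples stay bounded) — the `hVM` binder of K2E1-p11's
T head ★ `chiEisenstein_meromorphic_exports_kfinite_cm_three_of_gauge_letters` for the pure blocks below. [folklore] -/
theorem exists_bound_of_mem_span_kMaxTranslates {φ : (quasiSplit (↥(maximalRealSubfield L)) L (IsCMField.complexConj L) 3).Adelic → ℂ} (hφM : ∃ M : ℝ, ∀ x, ‖φ x‖ ≤ M) {ψ : (quasiSplit (↥(maximalRealSubfield L)) L (IsCMField.complexConj L) 3).Adelic → ℂ} (hψ : ψ ∈ (Submodule.span ℂ (Set.range fun k : ↥((standardMaximalCompactGL 3 L).comap (adelicVal (↥(maximalRealSubfield L)) L (IsCMField.complexConj L) 3 ((StdForm.antidiagonal 3).over L)) : Subgroup (quasiSplit (↥(maximalRealSubfield L)) L (IsCMField.complexConj L) 3).Adelic) => ((rightTranslation (quasiSplit (↥(maximalRealSubfield L)) L (IsCMField.complexConj L) 3)).comp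 ((standardMaximalCompactGL 3 L).comap (adelicVal (↥(maximalRealSubfield L)) L (IsCMField.complexConj L) 3 ((StdForm.antidiagonal 3).over L)) : Subgroup (quasiSplit (↥(maximalRealSubfield L)) L (IsCMField.complexConj L) 3).Adelic).subtype) k φ))) :
    ∃ M : ℝ, ∀ x, ‖ψ x‖ ≤ M := by
  induction hψ using Submodule.span_induction with
  | mem _ hx =>
    obtain ⟨k, rfl⟩ := hx
    obtain ⟨M, hM⟩ := hφM
    exact ⟨M, fun x => hM _⟩
  | zero => exact ⟨0, fun x => by simp⟩
  | add f g _ _ hf hg =>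
    obtain ⟨M, hM⟩ := hf
    obtain ⟨M', hM'⟩ := hg
    exact ⟨M + M', fun x => (norm_add_le _ _).trans (add_le_add (hM x) (hM' x))⟩
  | smul a f _ hf =>
    obtain ⟨M, hM⟩ := hf
    exact ⟨‖a‖ * M, fun x => by rw [Pi.smul_apply, norm_smul]; exact mul_le_mul_of_nonneg_left (hM x) (norm_nonneg a)⟩

/-! ## §5a PURITY: an irreducible finite-dimensional `K_max`-stable space of pair-sections lies in ONE `τ`-part, `τ` an irreducible `K_∞`-type -/

set_option maxHeartbeats 400000 in
/-- **§5a — PURITY OF `K_max`-IRREDUCIBLES — `le_chiSectionSpacePairKType_of_kMax_irreducible`**: let `U ≤ V(χ₁, χ₂; K′, ω)` be a finite-dimensional `K_max`-stable space of pair-sections on which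
`r(K_max)` is IRREDUCIBLE, the level `K′` commuting with `ι(K_∞)` (`hcomm`).  Then there is a minimal `K_∞`-stable `W₀ ≤ U` — an irreducible finite-dimensional `K_∞`-type `τ := r|_{W₀}` — with
`U ≤ V(χ₁, χ₂; K′, ω)^τ` (★ (3′) `chiSectionSpacePairKType`): the `τ`-part of `U` contains `W₀`, is `K_∞`-stable and `ι_f(G(𝒪̂)_f)`-stable (`r(ι_f c)|_U` is a `K_∞`-intertwiner), hence a
non-zero `K_max = ι(K_∞)·ι_f(G(𝒪̂)_f)`-subrepresentation of the irreducible `U`, hence `= U`. [cite: BrockerTomDieck1985, II (4.14)] [cite: WallachRRG1, §1.4.6–1.4.7] [cite: BorelJacquet1979, §4.1] -/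
theorem le_chiSectionSpacePairKType_of_kMax_irreducible {K' : Subgroup (quasiSplit (↥(maximalRealSubfield L)) L (IsCMField.complexConj L) 3).Adelic} {ω : ↥K' → ℂ}
    (hcomm : ∀ k : ↥(archMaximalCompact L), ∀ k' ∈ K', k' * (k : (quasiSplit (↥(maximalRealSubfield L)) L (IsCMField.complexConj L) 3).Adelic) = (k : (quasiSplit (↥(maximalRealSubfield L)) L (IsCMField.complexConj L) 3).Adelic) * k')
    (U : Submodule ℂ ((quasiSplit (↥(maximalRealSubfield L)) L (IsCMField.complexConj L) 3).Adelic → ℂ)) (hU : ∀ k : ↥((standardMaximalCompactGL 3 L).comap (adelicVal (↥(maximalRealSubfield L)) L (IsCMField.complexConj L) 3 ((StdForm.antidiagonal 3).over L)) : Subgroup (quasiSplit (↥(maximalRealSubfield L)) L (IsCMField.complexConj L) 3).Adelic), ∀ ψ ∈ U, ((rightTranslation (quasiSplit (↥(maximalRealSubfield L)) L (IsCMField.complexConj L) 3)).comp ((standardMaximalCompactGL 3 L).comap (adelicVal (↥(maximalRealSubfield L)) L (IsCMField.complexConj L) 3 ((StdForm.antidiagonal 3).over L)) : Subgroup (quasiSplit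 (↥(maximalRealSubfield L)) L (IsCMField.complexConj L) 3).Adelic).subtype) k ψ ∈ U) [hUfd : FiniteDimensional ℂ ↥U]
    (hirr : (Subrepresentation.toRepresentation (⟨U, hU⟩ : Subrepresentation ((rightTranslation (quasiSplit (↥(maximalRealSubfield L)) L (IsCMField.complexConj L) 3)).comp ((standardMaximalCompactGL 3 L).comap (adelicVal (↥(maximalRealSubfield L)) L (IsCMField.complexConj L) 3 ((StdForm.antidiagonal 3).over L)) : Subgroup (quasiSplit (↥(maximalRealSubfield L)) L (IsCMField.complexConj L) 3).Adelic).subtype))).IsIrreducible) (hUV : U ≤ chiSectionSpacePair χ₁ χ₂ K' ω) :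
    ∃ (W₀ : Submodule ℂ ((quasiSplit (↥(maximalRealSubfield L)) L (IsCMField.complexConj L) 3).Adelic → ℂ)) (hW₀K : ∀ k : ↥(archMaximalCompact L), ∀ ψ ∈ W₀, ((rightTranslation (quasiSplit (↥(maximalRealSubfield L)) L (IsCMField.complexConj L) 3)).comp (archMaximalCompact L).subtype) k ψ ∈ W₀),
      W₀ ≤ U ∧ FiniteDimensional ℂ ↥W₀ ∧ (Subrepresentation.toRepresentation (⟨W₀, hW₀K⟩ : Subrepresentation ((rightTranslation (quasiSplit (↥(maximalRealSubfield L)) L (IsCMField.complexConj L) 3)).comp (archMaximalCompact L).subtype))).IsIrreducible ∧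
      U ≤ chiSectionSpacePairKType χ₁ χ₂ K' ω (archMaximalCompact L).subtype hcomm (Subrepresentation.toRepresentation (⟨W₀, hW₀K⟩ : Subrepresentation ((rightTranslation (quasiSplit (↥(maximalRealSubfield L)) L (IsCMField.complexConj L) 3)).comp (archMaximalCompact L).subtype))) := by
  -- `K_∞ ≤ K_max` acts on `U`
  have hUinf : ∀ k : ↥(archMaximalCompact L), ∀ ψ ∈ U, ((rightTranslation (quasiSplit (↥(maximalRealSubfield L)) L (IsCMField.complexConj L) 3)).comp (archMaximalCompact L).subtype) k ψ ∈ U := fun k ψ hψ =>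
    hU ⟨(k : (quasiSplit (↥(maximalRealSubfield L)) L (IsCMField.complexConj L) 3).Adelic), archMaximalCompact_le_kMax L k.2⟩ ψ hψ
  -- `U ≠ ⊥` (an irreducible representation space is non-trivial)
  have hU0 : U ≠ ⊥ := by
    haveI := hirr
    obtain ⟨P, Q, hPQ⟩ := exists_pair_ne (Subrepresentation (Subrepresentation.toRepresentation (⟨U, hU⟩ : Subrepresentation ((rightTranslation (quasiSplit (↥(maximalRealSubfield L)) L (IsCMField.complexConj L) 3)).comp ((standardMaximalCompactGL 3 L).comap (adelicVal (↥(maximalRealSubfield L)) L (IsCMField.complexConj L) 3 ((StdForm.antidiagonal 3).over L)) : Subgroup (quasiSplit (↥(maximalRealSubfield L)) L (IsCMField.complexConj L) 3).Adelic).subtype))))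
    have hnt : Nontrivial (Submodule ℂ ↥U) := ⟨⟨P.toSubmodule, Q.toSubmodule, fun h => hPQ (Subrepresentation.toSubmodule_injective h)⟩⟩
    exact Submodule.nontrivial_iff_ne_bot.1 ((Submodule.nontrivial_iff ℂ).1 hnt)
  -- a minimal non-zero `K_∞`-stable `W₀ ≤ U`; it is irreducible
  obtain ⟨W₀, hW₀U, hW₀ne, hW₀K, hW₀min⟩ := Literature.NumberTheory.Automorphic.exists_minimal_stable_submodule ((rightTranslation (quasiSplit (↥(maximalRealSubfield L)) L (IsCMField.complexConj L) 3)).comp (archMaximalCompact L).subtype) U hU0 hUinf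
  haveI hW₀fd : FiniteDimensional ℂ ↥W₀ := Submodule.finiteDimensional_of_le hW₀U
  haveI : Nontrivial ↥W₀ := Submodule.nontrivial_iff_ne_bot.2 hW₀ne
  have hirr₀ : (Subrepresentation.toRepresentation (⟨W₀, hW₀K⟩ : Subrepresentation ((rightTranslation (quasiSplit (↥(maximalRealSubfield L)) L (IsCMField.complexConj L) 3)).comp (archMaximalCompact L).subtype))).IsIrreducible := by
    refine Literature.NumberTheory.Automorphic.isIrreducible_of_intertwiningMap_injective ((rightTranslation (quasiSplit (↥(maximalRealSubfield L)) L (IsCMField.complexConj L) 3)).comp (archMaximalCompact L).subtype)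
      ({ toLinearMap := W₀.subtype, isIntertwining' := fun k => rfl } : (Subrepresentation.toRepresentation (⟨W₀, hW₀K⟩ : Subrepresentation ((rightTranslation (quasiSplit (↥(maximalRealSubfield L)) L (IsCMField.complexConj L) 3)).comp (archMaximalCompact L).subtype))).IntertwiningMap ((rightTranslation (quasiSplit (↥(maximalRealSubfield L)) L (IsCMField.complexConj L) 3)).comp (archMaximalCompact L).subtype)) Subtype.val_injective fun U' hU' hU'le => ?_
    have hr : LinearMap.range W₀.subtype = W₀ := Submodule.range_subtype W₀
    change U' ≤ LinearMap.range W₀.subtype at hU'le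
    change U' = ⊥ ∨ U' = LinearMap.range W₀.subtype
    rw [hr] at hU'le ⊢
    exact hW₀min U' hU' hU'le
  refine ⟨W₀, hW₀K, hW₀U, hW₀fd, hirr₀, ?_⟩
  -- `W₀ ↪ U` is a `K_∞`-map `τ → r|_U`; the `τ`-part `T` of `U`, pushed into `G(𝔸) → ℂ`, is `D := T.map U.subtype ∋ W₀`
  let j : (Subrepresentation.toRepresentation (⟨W₀, hW₀K⟩ : Subrepresentation ((rightTranslation (quasiSplit (↥(maximalRealSubfield L)) L (IsCMField.complexConj L) 3)).comp (archMaximalCompact L).subtype))).IntertwiningMap (Subrepresentation.toRepresentation (⟨U, hUinf⟩ : Subrepresentation ((rightTranslation (quasiSplit (↥(maximalRealSubfield L)) L (IsCMField.complexConj L) 3)).comp (archMaximalCompact L).subtype))) :=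
    { toLinearMap := LinearMap.codRestrict U W₀.subtype fun w => hW₀U w.2
      isIntertwining' := fun k => LinearMap.ext fun w => Subtype.ext rfl }
  -- `T` is `K_max`-stable: `k = ι(a)·ι_f(c)`, `r(ι_f c)|_U` is a `K_∞`-intertwiner, `r(ι a)` preserves the `τ`-part
  have hTK : ∀ k : ↥((standardMaximalCompactGL 3 L).comap (adelicVal (↥(maximalRealSubfield L)) L (IsCMField.complexConj L) 3 ((StdForm.antidiagonal 3).over L)) : Subgroup (quasiSplit (↥(maximalRealSubfield L)) L (IsCMField.complexConj L) 3).Adelic), ∀ v ∈ Representation.homRangeSum (Subrepresentation.toRepresentation (⟨U, hUinf⟩ : Subrepresentation ((rightTranslation (quasiSplit (↥(maximalRealSubfield L)) L (IsCMField.complexConj L) 3)).comp (archMaximalCompact L).subtype))) (Subrepresentation.toRepresentation (⟨W₀, hW₀K⟩ : Subrepresentation ((rightTranslation (quasiSplit (↥(maximalRealSubfield L)) L (IsCMField.complexConj L) 3)).comp (archMaximalCompact L).subtype))), (Subrepresentation.toRepresentation (⟨U, hU⟩ : Subrepresentation ((rightTranslation (quasiSplit (↥(maximalRealSubfield L)) L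 (IsCMField.complexConj L) 3)).comp ((standardMaximalCompactGL 3 L).comap (adelicVal (↥(maximalRealSubfield L)) L (IsCMField.complexConj L) 3 ((StdForm.antidiagonal 3).over L)) : Subgroup (quasiSplit (↥(maximalRealSubfield L)) L (IsCMField.complexConj L) 3).Adelic).subtype))) k v ∈ Representation.homRangeSum (Subrepresentation.toRepresentation (⟨U, hUinf⟩ : Subrepresentation ((rightTranslation (quasiSplit (↥(maximalRealSubfield L)) L (IsCMField.complexConj L) 3)).comp (archMaximalCompact L).subtype))) (Subrepresentation.toRepresentation (⟨W₀, hW₀K⟩ : Subrepresentation ((rightTranslation (quasiSplit (↥(maximalRealSubfield L)) L (IsCMField.complexConj L) 3)).comp (archMaximalCompact L).subtype))) := by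
    intro k v hv
    obtain ⟨a, c, haK, hcK, hk_eq⟩ : ∃ (a : ↥(arch (↥(maximalRealSubfield L)) L (IsCMField.complexConj L) 3 ((StdForm.antidiagonal 3).over L))) (c : ↥(finAdelic (↥(maximalRealSubfield L)) L (IsCMField.complexConj L) 3 ((StdForm.antidiagonal 3).over L))), (adelicVal (↥(maximalRealSubfield L)) L (IsCMField.complexConj L) 3 ((StdForm.antidiagonal 3).over L)) ((archToAdelic (↥(maximalRealSubfield L)) L (IsCMField.complexConj L) 3 ((StdForm.antidiagonal 3).over L)) a) ∈ standardMaximalCompactGL 3 L ∧ c ∈ (finAdelicIntegralLevel (↥(maximalRealSubfield L)) L (IsCMField.complexConj L) 3 ((StdForm.antidiagonal 3).over L)) ∧ (k : (quasiSplit (↥(maximalRealSubfield L)) L (IsCMField.complexConj L) 3).Adelic) = (archToAdelic (↥(maximalRealSubfield L)) L (IsCMField.complexConj L) 3 ((StdForm.antidiagonal 3).over L)) a * (finAdelicToAdelic (↥(maximalRealSubfield L)) L (IsCMField.complexConj L) 3 ((StdForm.antidiagonal 3).over L)) c :=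
      ⟨_, _, adelicVal_archToAdelic_archPart_mem L k.2, finPart_mem_finAdelicIntegralLevel L k.2, (archToAdelic_mul_finAdelicToAdelic _ _ _ _ _ _).symm⟩
    let F : (Subrepresentation.toRepresentation (⟨U, hUinf⟩ : Subrepresentation ((rightTranslation (quasiSplit (↥(maximalRealSubfield L)) L (IsCMField.complexConj L) 3)).comp (archMaximalCompact L).subtype))).IntertwiningMap (Subrepresentation.toRepresentation (⟨U, hUinf⟩ : Subrepresentation ((rightTranslation (quasiSplit (↥(maximalRealSubfield L)) L (IsCMField.complexConj L) 3)).comp (archMaximalCompact L).subtype))) :=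
      { toLinearMap := (Subrepresentation.toRepresentation (⟨U, hU⟩ : Subrepresentation ((rightTranslation (quasiSplit (↥(maximalRealSubfield L)) L (IsCMField.complexConj L) 3)).comp ((standardMaximalCompactGL 3 L).comap (adelicVal (↥(maximalRealSubfield L)) L (IsCMField.complexConj L) 3 ((StdForm.antidiagonal 3).over L)) : Subgroup (quasiSplit (↥(maximalRealSubfield L)) L (IsCMField.complexConj L) 3).Adelic).subtype))) ⟨(finAdelicToAdelic (↥(maximalRealSubfield L)) L (IsCMField.complexConj L) 3 ((StdForm.antidiagonal 3).over L)) c, finAdelicToAdelic_mem_kMax L hcK⟩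
        isIntertwining' := fun k' => LinearMap.ext fun u => Subtype.ext (by
          obtain ⟨-, a', ha'⟩ := (mem_archMaximalCompact_iff L (k' : (quasiSplit (↥(maximalRealSubfield L)) L (IsCMField.complexConj L) 3).Adelic)).1 k'.2
          show (rightTranslation (quasiSplit (↥(maximalRealSubfield L)) L (IsCMField.complexConj L) 3)) ((finAdelicToAdelic (↥(maximalRealSubfield L)) L (IsCMField.complexConj L) 3 ((StdForm.antidiagonal 3).over L)) c) ((rightTranslation (quasiSplit (↥(maximalRealSubfield L)) L (IsCMField.complexConj L) 3)) (k' : (quasiSplit (↥(maximalRealSubfield L)) L (IsCMField.complexConj L) 3).Adelic) (u : (quasiSplit (↥(maximalRealSubfield L)) L (IsCMField.complexConj L) 3).Adelic → ℂ)) = (rightTranslation (quasiSplit (↥(maximalRealSubfield L)) L (IsCMField.complexConj L) 3)) (k' : (quasiSplit (↥(maximalRealSubfield L)) L (IsCMField.complexConj L) 3).Adelic) ((rightTranslation (quasiSplit (↥(maximalRealSubfield L)) L (IsCMField.complexConj L) 3)) ((finAdelicToAdelic (↥(maximalRealSubfield L)) L (IsCMField.complexConj L) 3 ((StdForm.antidiagonal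 3).over L)) c) (u : (quasiSplit (↥(maximalRealSubfield L)) L (IsCMField.complexConj L) 3).Adelic → ℂ))
          rw [← ha', rightTranslation_arch_fin_comm]) }
    have h1 : (Subrepresentation.toRepresentation (⟨U, hU⟩ : Subrepresentation ((rightTranslation (quasiSplit (↥(maximalRealSubfield L)) L (IsCMField.complexConj L) 3)).comp ((standardMaximalCompactGL 3 L).comap (adelicVal (↥(maximalRealSubfield L)) L (IsCMField.complexConj L) 3 ((StdForm.antidiagonal 3).over L)) : Subgroup (quasiSplit (↥(maximalRealSubfield L)) L (IsCMField.complexConj L) 3).Adelic).subtype))) ⟨(finAdelicToAdelic (↥(maximalRealSubfield L)) L (IsCMField.complexConj L) 3 ((StdForm.antidiagonal 3).over L)) c, finAdelicToAdelic_mem_kMax L hcK⟩ v ∈ Representation.homRangeSum (Subrepresentation.toRepresentation (⟨U, hUinf⟩ : Subrepresentation ((rightTranslation (quasiSplit (↥(maximalRealSubfield L)) L (IsCMField.complexConj L) 3)).comp (archMaximalCompact L).subtype))) (Subrepresentation.toRepresentation (⟨W₀, hW₀K⟩ : Subrepresentation ((rightTranslation (quasiSplit (↥(maximalRealSubfield L))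 L (IsCMField.complexConj L) 3)).comp (archMaximalCompact L).subtype))) :=
      Representation.map_homRangeSum_le F ⟨v, hv, rfl⟩
    have h2 := Representation.apply_mem_homRangeSum_of_mem (ρ := (Subrepresentation.toRepresentation (⟨U, hUinf⟩ : Subrepresentation ((rightTranslation (quasiSplit (↥(maximalRealSubfield L)) L (IsCMField.complexConj L) 3)).comp (archMaximalCompact L).subtype)))) (⟨(archToAdelic (↥(maximalRealSubfield L)) L (IsCMField.complexConj L) 3 ((StdForm.antidiagonal 3).over L)) a, archToAdelic_mem_archMaximalCompact L a haK⟩ : ↥(archMaximalCompact L)) h1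
    have h3 : (Subrepresentation.toRepresentation (⟨U, hU⟩ : Subrepresentation ((rightTranslation (quasiSplit (↥(maximalRealSubfield L)) L (IsCMField.complexConj L) 3)).comp ((standardMaximalCompactGL 3 L).comap (adelicVal (↥(maximalRealSubfield L)) L (IsCMField.complexConj L) 3 ((StdForm.antidiagonal 3).over L)) : Subgroup (quasiSplit (↥(maximalRealSubfield L)) L (IsCMField.complexConj L) 3).Adelic).subtype))) k v = (Subrepresentation.toRepresentation (⟨U, hUinf⟩ : Subrepresentation ((rightTranslation (quasiSplit (↥(maximalRealSubfield L)) L (IsCMField.complexConj L) 3)).comp (archMaximalCompact L).subtype))) ⟨(archToAdelic (↥(maximalRealSubfield L)) L (IsCMField.complexConj L) 3 ((StdForm.antidiagonal 3).over L)) a, archToAdelic_mem_archMaximalCompact L a haK⟩ ((Subrepresentation.toRepresentation (⟨U, hU⟩ : Subrepresentation ((rightTranslation (quasiSplit (↥(maximalRealSubfield L)) L (IsCMField.complexConj L) 3)).comp ((standardMaximalCompactGL 3 L).comap (adelicVal (↥(maximalRealSubfield L)) L (IsCMField.complexConj L) 3 ((StdForm.antidiagonal 3).over L)) : Subgroup (quasiSplit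 (↥(maximalRealSubfield L)) L (IsCMField.complexConj L) 3).Adelic).subtype))) ⟨(finAdelicToAdelic (↥(maximalRealSubfield L)) L (IsCMField.complexConj L) 3 ((StdForm.antidiagonal 3).over L)) c, finAdelicToAdelic_mem_kMax L hcK⟩ v) :=
      Subtype.ext (by
        show (rightTranslation (quasiSplit (↥(maximalRealSubfield L)) L (IsCMField.complexConj L) 3)) (k : (quasiSplit (↥(maximalRealSubfield L)) L (IsCMField.complexConj L) 3).Adelic) (v : (quasiSplit (↥(maximalRealSubfield L)) L (IsCMField.complexConj L) 3).Adelic → ℂ) = (rightTranslation (quasiSplit (↥(maximalRealSubfield L)) L (IsCMField.complexConj L) 3)) ((archToAdelic (↥(maximalRealSubfield L)) L (IsCMField.complexConj L) 3 ((StdForm.antidiagonal 3).over L)) a) ((rightTranslation (quasiSplit (↥(maximalRealSubfield L)) L (IsCMField.complexConj L) 3)) ((finAdelicToAdelic (↥(maximalRealSubfield L)) L (IsCMField.complexConj L) 3 ((StdForm.antidiagonal 3).over L)) c) (v : (quasiSplit (↥(maximalRealSubfield L)) L (IsCMField.complexConj L) 3).Adelic → ℂ))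
        rw [hk_eq, rightTranslation_mul_apply])
    rw [h3]
    exact h2
  -- `D := T.map U.subtype` is `K_max`-stable and contains a non-zero vector of the irreducible `U`, hence `U ≤ D` (★ `submodule_le_of_isIrreducible`)
  have hD : ∀ k : ↥((standardMaximalCompactGL 3 L).comap (adelicVal (↥(maximalRealSubfield L)) L (IsCMField.complexConj L) 3 ((StdForm.antidiagonal 3).over L)) : Subgroup (quasiSplit (↥(maximalRealSubfield L)) L (IsCMField.complexConj L) 3).Adelic), ∀ v ∈ (Representation.homRangeSum (Subrepresentation.toRepresentation (⟨U, hUinf⟩ : Subrepresentation ((rightTranslation (quasiSplit (↥(maximalRealSubfield L)) L (IsCMField.complexConj L) 3)).comp (archMaximalCompact L).subtype))) (Subrepresentation.toRepresentation (⟨W₀, hW₀K⟩ : Subrepresentation ((rightTranslation (quasiSplit (↥(maximalRealSubfield L)) L (IsCMField.complexConj L) 3)).comp (archMaximalCompact L).subtype)))).map U.subtype, ((rightTranslation (quasiSplit (↥(maximalRealSubfield L)) L (IsCMField.complexConj L) 3)).comp ((standardMaximalCompactGL 3 L).comap (adelicVal (↥(maximalRealSubfield L)) L (IsCMField.complexConj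 L) 3 ((StdForm.antidiagonal 3).over L)) : Subgroup (quasiSplit (↥(maximalRealSubfield L)) L (IsCMField.complexConj L) 3).Adelic).subtype) k v ∈ (Representation.homRangeSum (Subrepresentation.toRepresentation (⟨U, hUinf⟩ : Subrepresentation ((rightTranslation (quasiSplit (↥(maximalRealSubfield L)) L (IsCMField.complexConj L) 3)).comp (archMaximalCompact L).subtype))) (Subrepresentation.toRepresentation (⟨W₀, hW₀K⟩ : Subrepresentation ((rightTranslation (quasiSplit (↥(maximalRealSubfield L)) L (IsCMField.complexConj L) 3)).comp (archMaximalCompact L).subtype)))).map U.subtype := by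
    rintro k _ ⟨t, ht, rfl⟩
    exact ⟨_, hTK k t ht, rfl⟩
  obtain ⟨w, hw, hw0⟩ := (Submodule.ne_bot_iff W₀).1 hW₀ne
  have hUD : U ≤ (Representation.homRangeSum (Subrepresentation.toRepresentation (⟨U, hUinf⟩ : Subrepresentation ((rightTranslation (quasiSplit (↥(maximalRealSubfield L)) L (IsCMField.complexConj L) 3)).comp (archMaximalCompact L).subtype))) (Subrepresentation.toRepresentation (⟨W₀, hW₀K⟩ : Subrepresentation ((rightTranslation (quasiSplit (↥(maximalRealSubfield L)) L (IsCMField.complexConj L) 3)).comp (archMaximalCompact L).subtype)))).map U.subtype :=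
    submodule_le_of_isIrreducible ((rightTranslation (quasiSplit (↥(maximalRealSubfield L)) L (IsCMField.complexConj L) 3)).comp ((standardMaximalCompactGL 3 L).comap (adelicVal (↥(maximalRealSubfield L)) L (IsCMField.complexConj L) 3 ((StdForm.antidiagonal 3).over L)) : Subgroup (quasiSplit (↥(maximalRealSubfield L)) L (IsCMField.complexConj L) 3).Adelic).subtype) hU hirr hD (hW₀U hw) ⟨j ⟨w, hw⟩, Representation.apply_mem_homRangeSum j ⟨w, hw⟩, rfl⟩ hw0
  -- push `U ≤ D` into `V^τ` along the `K_∞`-map `U ↪ V(χ₁, χ₂; K′, ω)`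
  intro ψ hψ
  obtain ⟨t, ht, hteq⟩ := hUD hψ
  have htψ : t = ⟨ψ, hψ⟩ := Subtype.ext hteq
  rw [htψ] at ht
  let incl : (Subrepresentation.toRepresentation (⟨U, hUinf⟩ : Subrepresentation ((rightTranslation (quasiSplit (↥(maximalRealSubfield L)) L (IsCMField.complexConj L) 3)).comp (archMaximalCompact L).subtype))).IntertwiningMap (chiSectionPairSubrep χ₁ χ₂ K' ω (archMaximalCompact L).subtype hcomm).toRepresentation :=
    { toLinearMap := LinearMap.codRestrict (chiSectionSpacePair χ₁ χ₂ K' ω) U.subtype fun u => hUV u.2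
      isIntertwining' := fun k => LinearMap.ext fun u => Subtype.ext rfl }
  exact (mem_chiSectionSpacePairKType_iff ψ).2 ⟨hUV hψ, Representation.map_homRangeSum_le incl ⟨⟨ψ, hψ⟩, ht, rfl⟩⟩

/-! ## §5b SPLITTING: an arch-finite τ-admissible section is a finite sum of vectors in irreducible finite-dimensional `K_max`-stable spaces of sections -/

section Split

variable (ξ : OneDimAutRepH L) (μω : HeckeCharacter L)

/-- **§5b — THE SPLITTING — `exists_finset_sum_mem_kMax_irreducible`** (block characters of ★ D1∕★ β2): for `IsTauLevel U₀` and a continuous arch-finite `φ ∈ V(ξ.bcη⁻¹ξ.bcψ⁻¹μω, ξ.ψ; tauLevel U₀, 1)`,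
`φ = Σᵢ cᵢ` (finite) with `cᵢ ∈ Uᵢ ≤ S_φ := span r(K_max)φ`, each `Uᵢ` an IRREDUCIBLE finite-dimensional `K_max`-stable space — Weyl's unitarian trick on `K_max` (★ β2
`exists_invariant_definite_form_kMax`, definite on the continuous level-free pair-sections of `S_φ` ★ laws file 2) and complete reducibility (★ β2 `le_of_irreducibles_le_of_invariant_form`).
[cite: BrockerTomDieck1985, II (1.9)] [cite: WallachRRG1, §3.3.1] [cite: MoeglinWaldspurger1995, I.2.17] -/
theorem exists_finset_sum_mem_kMax_irreducible (hU₀ : IsTauLevel L U₀) {φ : (quasiSplit (↥(maximalRealSubfield L)) L (IsCMField.complexConj L) 3).Adelic → ℂ}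
    (hφ : φ ∈ chiSectionSpacePair (ξ.bcη⁻¹ * ξ.bcψ⁻¹ * μω) ξ.ψ (tauLevel L U₀) ((1 : ↥(tauLevel L U₀) →* ℂ) : ↥(tauLevel L U₀) → ℂ)) (hφc : Continuous φ) (hφa : IsArchFinite L φ) :
    ∃ (ι : Type) (_ : Fintype ι) (U : ι → Submodule ℂ ((quasiSplit (↥(maximalRealSubfield L)) L (IsCMField.complexConj L) 3).Adelic → ℂ)) (hU : ∀ i, ∀ k : ↥((standardMaximalCompactGL 3 L).comap (adelicVal (↥(maximalRealSubfield L)) L (IsCMField.complexConj L) 3 ((StdForm.antidiagonal 3).over L)) : Subgroup (quasiSplit (↥(maximalRealSubfield L)) L (IsCMField.complexConj L) 3).Adelic), ∀ ψ ∈ U i, ((rightTranslation (quasiSplit (↥(maximalRealSubfield L)) L (IsCMField.complexConj L) 3)).comp ((standardMaximalCompactGL 3 L).comap (adelicVal (↥(maximalRealSubfield L)) L (IsCMField.complexConj L) 3 ((StdForm.antidiagonal 3).over L)) : Subgroup (quasiSplit (↥(maximalRealSubfield L)) L (IsCMField.complexConj L) 3).Adelic).subtype) k ψ ∈ U i) (c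 : ι → ((quasiSplit (↥(maximalRealSubfield L)) L (IsCMField.complexConj L) 3).Adelic → ℂ)),
      φ = ∑ i, c i ∧ ∀ i, c i ∈ U i ∧ U i ≤ (Submodule.span ℂ (Set.range fun k : ↥((standardMaximalCompactGL 3 L).comap (adelicVal (↥(maximalRealSubfield L)) L (IsCMField.complexConj L) 3 ((StdForm.antidiagonal 3).over L)) : Subgroup (quasiSplit (↥(maximalRealSubfield L)) L (IsCMField.complexConj L) 3).Adelic) => ((rightTranslation (quasiSplit (↥(maximalRealSubfield L)) L (IsCMField.complexConj L) 3)).comp ((standardMaximalCompactGL 3 L).comap (adelicVal (↥(maximalRealSubfield L)) L (IsCMField.complexConj L) 3 ((StdForm.antidiagonal 3).over L)) : Subgroup (quasiSplit (↥(maximalRealSubfield L)) L (IsCMField.complexConj L) 3).Adelic).subtype) k φ)) ∧ FiniteDimensional ℂ ↥(U i) ∧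
        (Subrepresentation.toRepresentation (⟨U i, hU i⟩ : Subrepresentation ((rightTranslation (quasiSplit (↥(maximalRealSubfield L)) L (IsCMField.complexConj L) 3)).comp ((standardMaximalCompactGL 3 L).comap (adelicVal (↥(maximalRealSubfield L)) L (IsCMField.complexConj L) 3 ((StdForm.antidiagonal 3).over L)) : Subgroup (quasiSplit (↥(maximalRealSubfield L)) L (IsCMField.complexConj L) 3).Adelic).subtype))).IsIrreducible := by
  classical
  -- `S := span r(K_max)φ`: finite-dimensional, stable, continuous level-free pair-sections
  set S : Submodule ℂ ((quasiSplit (↥(maximalRealSubfield L)) L (IsCMField.complexConj L) 3).Adelic → ℂ) := (Submodule.span ℂ (Set.range fun k : ↥((standardMaximalCompactGL 3 L).comap (adelicVal (↥(maximalRealSubfield L)) L (IsCMField.complexConj L) 3 ((StdForm.antidiagonal 3).over L)) : Subgroup (quasiSplit (↥(maximalRealSubfield L)) L (IsCMField.complexConj L) 3).Adelic) => ((rightTranslation (quasiSplit (↥(maximalRealSubfield L)) L (IsCMField.complexConj L) 3)).comp ((standardMaximalCompactGL 3 L).comap (adelicVal (↥(maximalRealSubfield L)) L (IsCMField.complexConj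 L) 3 ((StdForm.antidiagonal 3).over L)) : Subgroup (quasiSplit (↥(maximalRealSubfield L)) L (IsCMField.complexConj L) 3).Adelic).subtype) k φ)) with hSdef
  haveI hSfd : FiniteDimensional ℂ ↥S := finiteDimensional_span_comp_subtype_kMax_of_mem_chiSectionSpacePair_tauLevel L hU₀ hφ hφa
  have hSK : ∀ k : ↥((standardMaximalCompactGL 3 L).comap (adelicVal (↥(maximalRealSubfield L)) L (IsCMField.complexConj L) 3 ((StdForm.antidiagonal 3).over L)) : Subgroup (quasiSplit (↥(maximalRealSubfield L)) L (IsCMField.complexConj L) 3).Adelic), ∀ ψ ∈ S, ((rightTranslation (quasiSplit (↥(maximalRealSubfield L)) L (IsCMField.complexConj L) 3)).comp ((standardMaximalCompactGL 3 L).comap (adelicVal (↥(maximalRealSubfield L)) L (IsCMField.complexConj L) 3 ((StdForm.antidiagonal 3).over L)) : Subgroup (quasiSplit (↥(maximalRealSubfield L)) L (IsCMField.complexConj L) 3).Adelic).subtype) k ψ ∈ S := fun k ψ hψ => rightTranslation_mem_span_kMaxTranslates L φ k hψ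
  have hSV : S ≤ chiSectionSpacePair (ξ.bcη⁻¹ * ξ.bcψ⁻¹ * μω) ξ.ψ (⊥ : Subgroup (quasiSplit (↥(maximalRealSubfield L)) L (IsCMField.complexConj L) 3).Adelic) ((1 : ↥(⊥ : Subgroup (quasiSplit (↥(maximalRealSubfield L)) L (IsCMField.complexConj L) 3).Adelic) →* ℂ) : ↥(⊥ : Subgroup (quasiSplit (↥(maximalRealSubfield L)) L (IsCMField.complexConj L) 3).Adelic) → ℂ) := span_kMaxTranslates_le_chiSectionSpacePair_bot L hφ
  have hSc : ∀ ψ ∈ S, Continuous ψ := fun ψ hψ => continuous_of_mem_span_rightTranslation L hφc hψ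
  have hφS : φ ∈ S := mem_span_kMaxTranslates_self L φ
  -- the unitarian trick and complete reducibility on `↥S` (the `K_max`-action `ρS` on `↥S`)
  obtain ⟨B, hBinv, hBdef⟩ := exists_invariant_definite_form_kMax L ξ μω S hSK hSV hSc
  let ρS : Representation ℂ ↥((standardMaximalCompactGL 3 L).comap (adelicVal (↥(maximalRealSubfield L)) L (IsCMField.complexConj L) 3 ((StdForm.antidiagonal 3).over L)) : Subgroup (quasiSplit (↥(maximalRealSubfield L)) L (IsCMField.complexConj L) 3).Adelic) ↥S := Subrepresentation.toRepresentation (⟨S, hSK⟩ : Subrepresentation ((rightTranslation (quasiSplit (↥(maximalRealSubfield L)) L (IsCMField.complexConj L) 3)).comp ((standardMaximalCompactGL 3 L).comap (adelicVal (↥(maximalRealSubfield L)) L (IsCMField.complexConj L) 3 ((StdForm.antidiagonal 3).over L)) : Subgroup (quasiSplit (↥(maximalRealSubfield L)) L (IsCMField.complexConj L) 3).Adelic).subtype))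
  -- index: the irreducible stable subspaces of `↥S`
  let J : Type := {W : Submodule ℂ ↥S // ∃ hW : ∀ k : ↥((standardMaximalCompactGL 3 L).comap (adelicVal (↥(maximalRealSubfield L)) L (IsCMField.complexConj L) 3 ((StdForm.antidiagonal 3).over L)) : Subgroup (quasiSplit (↥(maximalRealSubfield L)) L (IsCMField.complexConj L) 3).Adelic), ∀ w ∈ W, ρS k w ∈ W,
    @Representation.IsIrreducible ↥((standardMaximalCompactGL 3 L).comap (adelicVal (↥(maximalRealSubfield L)) L (IsCMField.complexConj L) 3 ((StdForm.antidiagonal 3).over L)) : Subgroup (quasiSplit (↥(maximalRealSubfield L)) L (IsCMField.complexConj L) 3).Adelic) ℂ ↥W _ _ _ _ (Subrepresentation.toRepresentation (⟨W, hW⟩ : Subrepresentation ρS))}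
  have htop : (⟨φ, hφS⟩ : ↥S) ∈ ⨆ j : J, (j.1 : Submodule ℂ ↥S) :=
    le_of_irreducibles_le_of_invariant_form ρS B hBinv ⊤
      (fun k v _ => Submodule.mem_top) (fun a _ => hBdef a) (⨆ j : J, (j.1 : Submodule ℂ ↥S))
      (fun W hW _ _ hWirr => le_iSup (fun j : J => (j.1 : Submodule ℂ ↥S)) ⟨W, hW, hWirr⟩) (Submodule.mem_top : (⟨φ, hφS⟩ : ↥S) ∈ (⊤ : Submodule ℂ ↥S))
  -- extract a finite sum
  obtain ⟨s, hs⟩ := Submodule.mem_iSup_iff_exists_finset.1 htop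
  obtain ⟨m, hm⟩ := (Submodule.mem_iSup_finset_iff_exists_sum (fun j : J => (j.1 : Submodule ℂ ↥S)) _).1 hs
  -- transport each piece to `G(𝔸) → ℂ` along `S ↪`
  have hUK : ∀ j : J, ∀ k : ↥((standardMaximalCompactGL 3 L).comap (adelicVal (↥(maximalRealSubfield L)) L (IsCMField.complexConj L) 3 ((StdForm.antidiagonal 3).over L)) : Subgroup (quasiSplit (↥(maximalRealSubfield L)) L (IsCMField.complexConj L) 3).Adelic), ∀ ψ ∈ (j.1 : Submodule ℂ ↥S).map S.subtype, ((rightTranslation (quasiSplit (↥(maximalRealSubfield L)) L (IsCMField.complexConj L) 3)).comp ((standardMaximalCompactGL 3 L).comap (adelicVal (↥(maximalRealSubfield L)) L (IsCMField.complexConj L) 3 ((StdForm.antidiagonal 3).over L)) : Subgroup (quasiSplit (↥(maximalRealSubfield L)) L (IsCMField.complexConj L) 3).Adelic).subtype) k ψ ∈ (j.1 : Submodule ℂ ↥S).map S.subtype := by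
    rintro j k _ ⟨w, hw, rfl⟩
    obtain ⟨hW, -⟩ := j.2
    exact ⟨_, hW k w hw, rfl⟩
  refine ⟨↥s, inferInstance, fun i => ((i.1).1 : Submodule ℂ ↥S).map S.subtype, fun i => hUK i.1, fun i => ((m i.1 : ↥((i.1).1 : Submodule ℂ ↥S)) : ↥S), ?_, fun i => ⟨?_, ?_, ?_, ?_⟩⟩
  · -- `φ = Σ_{i ∈ s} m i`
    have h := congrArg (fun x : ↥S => (x : (quasiSplit (↥(maximalRealSubfield L)) L (IsCMField.complexConj L) 3).Adelic → ℂ)) hm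
    simp only [Submodule.coe_sum] at h
    exact h.symm.trans (Finset.sum_coe_sort s (fun j : J => (((m j : ↥((j.1 : Submodule ℂ ↥S))) : ↥S) : (quasiSplit (↥(maximalRealSubfield L)) L (IsCMField.complexConj L) 3).Adelic → ℂ))).symm
  · exact ⟨_, (m i.1).2, rfl⟩
  · exact Submodule.map_subtype_le _ _
  · exact Module.Finite.map _ _
  · obtain ⟨hW, hWirr⟩ := (i.1).2
    exact isIrreducible_of_equiv (Representation.Equiv.mk (S.equivSubtypeMap ((i.1).1 : Submodule ℂ ↥S)) fun k => LinearMap.ext fun w => Subtype.ext (by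
      simp only [LinearMap.coe_comp, Function.comp_apply, LinearEquiv.coe_coe, Submodule.equivSubtypeMap_apply, LinearMap.domRestrict_apply, Submodule.subtype_apply]
      rfl)) hWirr

end Split

/-! ## §5c HEAD: the pure-type splitting of an arch-finite τ-admissible section -/

section Head

variable (ξ : OneDimAutRepH L) (μω : HeckeCharacter L)

/-- **§5c HEAD — `exists_finset_sum_mem_chiSectionSpacePairKType_of_isArchFinite`**: at a NORMAL τ-level (`IsTauLevel U₀`, `hN : G(𝒪̂)_f` normalises `U₀` — the levels of record `K(𝔫)_f` qualify),
every continuous arch-finite section `φ ∈ V(ξ.bcη⁻¹ξ.bcψ⁻¹μω, ξ.ψ; tauLevel U₀, 1)` (the section clauses of a τ-admissible generator ★ `resGMidAtomGenτ`) is a FINITE SUM `φ = Σᵢ cᵢ` of CONTINUOUS,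
ARCH-FINITE sections `cᵢ ∈ span r(K_max)φ`, each lying in ONE `τᵢ`-part `V(…; tauLevel U₀, 1)^{τᵢ}` (★ (3′)) for an IRREDUCIBLE finite-dimensional `K_∞`-type `τᵢ` (realised on a `K_∞`-stable
`Wᵢ`) — the currency the 12d-C_τ port consumes together with multiplicity one (α).  (§5b, then §5a on each irreducible `K_max`-piece at the level kept by `hN`.)
[cite: BrockerTomDieck1985, II (1.9), (4.14)] [cite: WallachRRG1, §3.3.1] [cite: MoeglinWaldspurger1995, I.2.17] [cite: BorelJacquet1979, §4.1] -/
theorem exists_finset_sum_mem_chiSectionSpacePairKType_of_isArchFinite (hU₀ : IsTauLevel L U₀) (hN : ∀ b ∈ (finAdelicIntegralLevel (↥(maximalRealSubfield L)) L (IsCMField.complexConj L) 3 ((StdForm.antidiagonal 3).over L)), ∀ u ∈ U₀, b * u * b⁻¹ ∈ U₀)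
    {φ : (quasiSplit (↥(maximalRealSubfield L)) L (IsCMField.complexConj L) 3).Adelic → ℂ} (hφ : φ ∈ chiSectionSpacePair (ξ.bcη⁻¹ * ξ.bcψ⁻¹ * μω) ξ.ψ (tauLevel L U₀) ((1 : ↥(tauLevel L U₀) →* ℂ) : ↥(tauLevel L U₀) → ℂ)) (hφc : Continuous φ) (hφa : IsArchFinite L φ) :
    ∃ (ι : Type) (_ : Fintype ι) (c : ι → ((quasiSplit (↥(maximalRealSubfield L)) L (IsCMField.complexConj L) 3).Adelic → ℂ)), φ = ∑ i, c i ∧ ∀ i,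
      c i ∈ (Submodule.span ℂ (Set.range fun k : ↥((standardMaximalCompactGL 3 L).comap (adelicVal (↥(maximalRealSubfield L)) L (IsCMField.complexConj L) 3 ((StdForm.antidiagonal 3).over L)) : Subgroup (quasiSplit (↥(maximalRealSubfield L)) L (IsCMField.complexConj L) 3).Adelic) => ((rightTranslation (quasiSplit (↥(maximalRealSubfield L)) L (IsCMField.complexConj L) 3)).comp ((standardMaximalCompactGL 3 L).comap (adelicVal (↥(maximalRealSubfield L)) L (IsCMField.complexConj L) 3 ((StdForm.antidiagonal 3).over L)) : Subgroup (quasiSplit (↥(maximalRealSubfield L)) L (IsCMField.complexConj L) 3).Adelic).subtype) k φ)) ∧ Continuous (c i) ∧ IsArchFinite L (c i) ∧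
      ∃ (W₀ : Submodule ℂ ((quasiSplit (↥(maximalRealSubfield L)) L (IsCMField.complexConj L) 3).Adelic → ℂ)) (hW₀K : ∀ k : ↥(archMaximalCompact L), ∀ ψ ∈ W₀, ((rightTranslation (quasiSplit (↥(maximalRealSubfield L)) L (IsCMField.complexConj L) 3)).comp (archMaximalCompact L).subtype) k ψ ∈ W₀),
        FiniteDimensional ℂ ↥W₀ ∧ (Subrepresentation.toRepresentation (⟨W₀, hW₀K⟩ : Subrepresentation ((rightTranslation (quasiSplit (↥(maximalRealSubfield L)) L (IsCMField.complexConj L) 3)).comp (archMaximalCompact L).subtype))).IsIrreducible ∧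
        c i ∈ chiSectionSpacePairKType (ξ.bcη⁻¹ * ξ.bcψ⁻¹ * μω) ξ.ψ (tauLevel L U₀) ((1 : ↥(tauLevel L U₀) →* ℂ) : ↥(tauLevel L U₀) → ℂ) (archMaximalCompact L).subtype (commute_tauLevel_archMaximalCompact L U₀) (Subrepresentation.toRepresentation (⟨W₀, hW₀K⟩ : Subrepresentation ((rightTranslation (quasiSplit (↥(maximalRealSubfield L)) L (IsCMField.complexConj L) 3)).comp (archMaximalCompact L).subtype))) := by
  obtain ⟨ι, hι, U, hU, c, hsum, hc⟩ := exists_finset_sum_mem_kMax_irreducible L ξ μω hU₀ hφ hφc hφa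
  refine ⟨ι, hι, c, hsum, fun i => ?_⟩
  obtain ⟨hcU, hUS, hUfd, hUirr⟩ := hc i
  haveI := hUfd
  have hUV : U i ≤ chiSectionSpacePair (ξ.bcη⁻¹ * ξ.bcψ⁻¹ * μω) ξ.ψ (tauLevel L U₀) ((1 : ↥(tauLevel L U₀) →* ℂ) : ↥(tauLevel L U₀) → ℂ) := hUS.trans (span_kMaxTranslates_le_chiSectionSpacePair_tauLevel L hN hφ)
  obtain ⟨W₀, hW₀K, -, hW₀fd, hirr₀, hle⟩ := le_chiSectionSpacePairKType_of_kMax_irreducible L (commute_tauLevel_archMaximalCompact L U₀) (U i) (hU i) hUirr hUV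
  exact ⟨hUS hcU, continuous_of_mem_span_rightTranslation L hφc (hUS hcU),
    isArchFinite_of_mem_of_finiteDimensional L (fun k ψ hψ => hU i ⟨(k : (quasiSplit (↥(maximalRealSubfield L)) L (IsCMField.complexConj L) 3).Adelic), archMaximalCompact_le_kMax L k.2⟩ ψ hψ) hcU, W₀, hW₀K, hW₀fd, hirr₀, hle hcU⟩

/-- **§5c, LEVEL-FREE TWIN — `exists_finset_sum_mem_chiSectionSpacePairKType_bot_of_isArchFinite`** (no normality hypothesis): the same splitting with purity read in the level-free section
space `V(…; ⊥, 1)^{τᵢ}` (`hcomm` vacuous, ★ `commute_of_mem_bot`). [cite: BrockerTomDieck1985, II (1.9), (4.14)] [cite: WallachRRG1, §3.3.1] [cite: MoeglinWaldspurger1995, I.2.17] -/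
theorem exists_finset_sum_mem_chiSectionSpacePairKType_bot_of_isArchFinite (hU₀ : IsTauLevel L U₀)
    {φ : (quasiSplit (↥(maximalRealSubfield L)) L (IsCMField.complexConj L) 3).Adelic → ℂ} (hφ : φ ∈ chiSectionSpacePair (ξ.bcη⁻¹ * ξ.bcψ⁻¹ * μω) ξ.ψ (tauLevel L U₀) ((1 : ↥(tauLevel L U₀) →* ℂ) : ↥(tauLevel L U₀) → ℂ)) (hφc : Continuous φ) (hφa : IsArchFinite L φ) :
    ∃ (ι : Type) (_ : Fintype ι) (c : ι → ((quasiSplit (↥(maximalRealSubfield L)) L (IsCMField.complexConj L) 3).Adelic → ℂ)), φ = ∑ i, c i ∧ ∀ i,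
      c i ∈ (Submodule.span ℂ (Set.range fun k : ↥((standardMaximalCompactGL 3 L).comap (adelicVal (↥(maximalRealSubfield L)) L (IsCMField.complexConj L) 3 ((StdForm.antidiagonal 3).over L)) : Subgroup (quasiSplit (↥(maximalRealSubfield L)) L (IsCMField.complexConj L) 3).Adelic) => ((rightTranslation (quasiSplit (↥(maximalRealSubfield L)) L (IsCMField.complexConj L) 3)).comp ((standardMaximalCompactGL 3 L).comap (adelicVal (↥(maximalRealSubfield L)) L (IsCMField.complexConj L) 3 ((StdForm.antidiagonal 3).over L)) : Subgroup (quasiSplit (↥(maximalRealSubfield L)) L (IsCMField.complexConj L) 3).Adelic).subtype) k φ)) ∧ Continuous (c i) ∧ IsArchFinite L (c i) ∧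
      ∃ (W₀ : Submodule ℂ ((quasiSplit (↥(maximalRealSubfield L)) L (IsCMField.complexConj L) 3).Adelic → ℂ)) (hW₀K : ∀ k : ↥(archMaximalCompact L), ∀ ψ ∈ W₀, ((rightTranslation (quasiSplit (↥(maximalRealSubfield L)) L (IsCMField.complexConj L) 3)).comp (archMaximalCompact L).subtype) k ψ ∈ W₀),
        FiniteDimensional ℂ ↥W₀ ∧ (Subrepresentation.toRepresentation (⟨W₀, hW₀K⟩ : Subrepresentation ((rightTranslation (quasiSplit (↥(maximalRealSubfield L)) L (IsCMField.complexConj L) 3)).comp (archMaximalCompact L).subtype))).IsIrreducible ∧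
        c i ∈ chiSectionSpacePairKType (ξ.bcη⁻¹ * ξ.bcψ⁻¹ * μω) ξ.ψ (⊥ : Subgroup (quasiSplit (↥(maximalRealSubfield L)) L (IsCMField.complexConj L) 3).Adelic) ((1 : ↥(⊥ : Subgroup (quasiSplit (↥(maximalRealSubfield L)) L (IsCMField.complexConj L) 3).Adelic) →* ℂ) : ↥(⊥ : Subgroup (quasiSplit (↥(maximalRealSubfield L)) L (IsCMField.complexConj L) 3).Adelic) → ℂ) (archMaximalCompact L).subtype (commute_of_mem_bot (archMaximalCompact L).subtype) (Subrepresentation.toRepresentation (⟨W₀, hW₀K⟩ : Subrepresentation ((rightTranslation (quasiSplit (↥(maximalRealSubfield L)) L (IsCMField.complexConj L) 3)).comp (archMaximalCompact L).subtype))) := by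
  obtain ⟨ι, hι, U, hU, c, hsum, hc⟩ := exists_finset_sum_mem_kMax_irreducible L ξ μω hU₀ hφ hφc hφa
  refine ⟨ι, hι, c, hsum, fun i => ?_⟩
  obtain ⟨hcU, hUS, hUfd, hUirr⟩ := hc i
  haveI := hUfd
  have hUV : U i ≤ chiSectionSpacePair (ξ.bcη⁻¹ * ξ.bcψ⁻¹ * μω) ξ.ψ (⊥ : Subgroup (quasiSplit (↥(maximalRealSubfield L)) L (IsCMField.complexConj L) 3).Adelic) ((1 : ↥(⊥ : Subgroup (quasiSplit (↥(maximalRealSubfield L)) L (IsCMField.complexConj L) 3).Adelic) →* ℂ) : ↥(⊥ : Subgroup (quasiSplit (↥(maximalRealSubfield L)) L (IsCMField.complexConj L) 3).Adelic) → ℂ) := hUS.trans (span_kMaxTranslates_le_chiSectionSpacePair_bot L hφ)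
  obtain ⟨W₀, hW₀K, -, hW₀fd, hirr₀, hle⟩ := le_chiSectionSpacePairKType_of_kMax_irreducible L (commute_of_mem_bot (archMaximalCompact L).subtype) (U i) (hU i) hUirr hUV
  exact ⟨hUS hcU, continuous_of_mem_span_rightTranslation L hφc (hUS hcU),
    isArchFinite_of_mem_of_finiteDimensional L (fun k ψ hψ => hU i ⟨(k : (quasiSplit (↥(maximalRealSubfield L)) L (IsCMField.complexConj L) 3).Adelic), archMaximalCompact_le_kMax L k.2⟩ ψ hψ) hcU, W₀, hW₀K, hW₀fd, hirr₀, hle hcU⟩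

/-- **§5d — THE CONSUMER PACKAGE — `exists_finset_sum_pure_blocks_of_isArchFinite`** (RULING J-S8-T2′: «the four V-facts `hVK hVχ hVc hVM` + `FiniteDimensional` under K2E1-p11's names»):
at a normal τ-level, a continuous BOUNDED arch-finite τ-admissible section `φ` is a finite sum `φ = Σᵢ cᵢ`, `cᵢ ∈ Vᵢ ≤ span r(K_max)φ`, where each block `Vᵢ` is FINITE-DIMENSIONAL, `K_max`-STABLE
(`hVK` in the spelling `(fun x => ψ (x * k)) ∈ Vᵢ`), made of CONTINUOUS (`hVc`) BOUNDED (`hVM`) `(χ₁, χ₂)`-PAIR-SECTIONS (`hVχ`) at the level `(tauLevel U₀, 1)`, IRREDUCIBLE under `K_max`, and of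
PURE `K_∞`-TYPE: `Vᵢ ≤ V(…; tauLevel U₀, 1)^{τᵢ}` for an irreducible finite-dimensional `K_∞`-type `τᵢ` — the `V` of ★ `chiEisenstein_meromorphic_exports_kfinite_cm_three_of_gauge_letters`
(p864350) together with the purity the 12d-C_τ port (★ p864413) needs. [cite: BrockerTomDieck1985, II (1.9), (4.14)] [cite: WallachRRG1, §3.3.1] [cite: MoeglinWaldspurger1995, I.2.17]
[cite: BorelJacquet1979, §4.1] -/
theorem exists_finset_sum_pure_blocks_of_isArchFinite (hU₀ : IsTauLevel L U₀) (hN : ∀ b ∈ (finAdelicIntegralLevel (↥(maximalRealSubfield L)) L (IsCMField.complexConj L) 3 ((StdForm.antidiagonal 3).over L)), ∀ u ∈ U₀, b * u * b⁻¹ ∈ U₀)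
    {φ : (quasiSplit (↥(maximalRealSubfield L)) L (IsCMField.complexConj L) 3).Adelic → ℂ} (hφ : φ ∈ chiSectionSpacePair (ξ.bcη⁻¹ * ξ.bcψ⁻¹ * μω) ξ.ψ (tauLevel L U₀) ((1 : ↥(tauLevel L U₀) →* ℂ) : ↥(tauLevel L U₀) → ℂ)) (hφc : Continuous φ) (hφM : ∃ M : ℝ, ∀ x, ‖φ x‖ ≤ M)
    (hφa : IsArchFinite L φ) :
    ∃ (ι : Type) (_ : Fintype ι) (V : ι → Submodule ℂ ((quasiSplit (↥(maximalRealSubfield L)) L (IsCMField.complexConj L) 3).Adelic → ℂ)) (c : ι → ((quasiSplit (↥(maximalRealSubfield L)) L (IsCMField.complexConj L) 3).Adelic → ℂ)), φ = ∑ i, c i ∧ ∀ i,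
      c i ∈ V i ∧ V i ≤ (Submodule.span ℂ (Set.range fun k : ↥((standardMaximalCompactGL 3 L).comap (adelicVal (↥(maximalRealSubfield L)) L (IsCMField.complexConj L) 3 ((StdForm.antidiagonal 3).over L)) : Subgroup (quasiSplit (↥(maximalRealSubfield L)) L (IsCMField.complexConj L) 3).Adelic) => ((rightTranslation (quasiSplit (↥(maximalRealSubfield L)) L (IsCMField.complexConj L) 3)).comp ((standardMaximalCompactGL 3 L).comap (adelicVal (↥(maximalRealSubfield L)) L (IsCMField.complexConj L) 3 ((StdForm.antidiagonal 3).over L)) : Subgroup (quasiSplit (↥(maximalRealSubfield L)) L (IsCMField.complexConj L) 3).Adelic).subtype) k φ)) ∧ FiniteDimensional ℂ ↥(V i) ∧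
      (∀ k ∈ ((standardMaximalCompactGL 3 L).comap (adelicVal (↥(maximalRealSubfield L)) L (IsCMField.complexConj L) 3 ((StdForm.antidiagonal 3).over L)) : Subgroup (quasiSplit (↥(maximalRealSubfield L)) L (IsCMField.complexConj L) 3).Adelic), ∀ ψ ∈ V i, (fun x => ψ (x * k)) ∈ V i) ∧
      (∀ ψ ∈ V i, IsChiSectionPair (ξ.bcη⁻¹ * ξ.bcψ⁻¹ * μω) ξ.ψ ψ) ∧ (∀ ψ ∈ V i, Continuous ψ) ∧ (∀ ψ ∈ V i, ∃ M : ℝ, ∀ x, ‖ψ x‖ ≤ M) ∧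
      V i ≤ chiSectionSpacePair (ξ.bcη⁻¹ * ξ.bcψ⁻¹ * μω) ξ.ψ (tauLevel L U₀) ((1 : ↥(tauLevel L U₀) →* ℂ) : ↥(tauLevel L U₀) → ℂ) ∧
      (∃ hV : ∀ k : ↥((standardMaximalCompactGL 3 L).comap (adelicVal (↥(maximalRealSubfield L)) L (IsCMField.complexConj L) 3 ((StdForm.antidiagonal 3).over L)) : Subgroup (quasiSplit (↥(maximalRealSubfield L)) L (IsCMField.complexConj L) 3).Adelic), ∀ ψ ∈ V i, ((rightTranslation (quasiSplit (↥(maximalRealSubfield L)) L (IsCMField.complexConj L) 3)).comp ((standardMaximalCompactGL 3 L).comap (adelicVal (↥(maximalRealSubfield L)) L (IsCMField.complexConj L) 3 ((StdForm.antidiagonal 3).over L)) : Subgroup (quasiSplit (↥(maximalRealSubfield L)) L (IsCMField.complexConj L) 3).Adelic).subtype) k ψ ∈ V i, (Subrepresentation.toRepresentation (⟨V i, hV⟩ : Subrepresentation ((rightTranslation (quasiSplit (↥(maximalRealSubfield L)) L (IsCMField.complexConj L) 3)).comp ((standardMaximalCompactGL 3 L).comap (adelicVal (↥(maximalRealSubfield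 L)) L (IsCMField.complexConj L) 3 ((StdForm.antidiagonal 3).over L)) : Subgroup (quasiSplit (↥(maximalRealSubfield L)) L (IsCMField.complexConj L) 3).Adelic).subtype))).IsIrreducible) ∧
      ∃ (W₀ : Submodule ℂ ((quasiSplit (↥(maximalRealSubfield L)) L (IsCMField.complexConj L) 3).Adelic → ℂ)) (hW₀K : ∀ k : ↥(archMaximalCompact L), ∀ ψ ∈ W₀, ((rightTranslation (quasiSplit (↥(maximalRealSubfield L)) L (IsCMField.complexConj L) 3)).comp (archMaximalCompact L).subtype) k ψ ∈ W₀),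
        FiniteDimensional ℂ ↥W₀ ∧ (Subrepresentation.toRepresentation (⟨W₀, hW₀K⟩ : Subrepresentation ((rightTranslation (quasiSplit (↥(maximalRealSubfield L)) L (IsCMField.complexConj L) 3)).comp (archMaximalCompact L).subtype))).IsIrreducible ∧
        V i ≤ chiSectionSpacePairKType (ξ.bcη⁻¹ * ξ.bcψ⁻¹ * μω) ξ.ψ (tauLevel L U₀) ((1 : ↥(tauLevel L U₀) →* ℂ) : ↥(tauLevel L U₀) → ℂ) (archMaximalCompact L).subtype (commute_tauLevel_archMaximalCompact L U₀) (Subrepresentation.toRepresentation (⟨W₀, hW₀K⟩ : Subrepresentation ((rightTranslation (quasiSplit (↥(maximalRealSubfield L)) L (IsCMField.complexConj L) 3)).comp (archMaximalCompact L).subtype))) := by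
  obtain ⟨ι, hι, U, hU, c, hsum, hc⟩ := exists_finset_sum_mem_kMax_irreducible L ξ μω hU₀ hφ hφc hφa
  have hSV : (Submodule.span ℂ (Set.range fun k : ↥((standardMaximalCompactGL 3 L).comap (adelicVal (↥(maximalRealSubfield L)) L (IsCMField.complexConj L) 3 ((StdForm.antidiagonal 3).over L)) : Subgroup (quasiSplit (↥(maximalRealSubfield L)) L (IsCMField.complexConj L) 3).Adelic) => ((rightTranslation (quasiSplit (↥(maximalRealSubfield L)) L (IsCMField.complexConj L) 3)).comp ((standardMaximalCompactGL 3 L).comap (adelicVal (↥(maximalRealSubfield L)) L (IsCMField.complexConj L) 3 ((StdForm.antidiagonal 3).over L)) : Subgroup (quasiSplit (↥(maximalRealSubfield L)) L (IsCMField.complexConj L) 3).Adelic).subtype) k φ)) ≤ chiSectionSpacePair (ξ.bcη⁻¹ * ξ.bcψ⁻¹ * μω) ξ.ψ (tauLevel L U₀) ((1 : ↥(tauLevel L U₀) →* ℂ) : ↥(tauLevel L U₀) → ℂ) := span_kMaxTranslates_le_chiSectionSpacePair_tauLevel L hN hφ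
  refine ⟨ι, hι, U, c, hsum, fun i => ?_⟩
  obtain ⟨hcU, hUS, hUfd, hUirr⟩ := hc i
  haveI := hUfd
  obtain ⟨W₀, hW₀K, -, hW₀fd, hirr₀, hle⟩ :=
    le_chiSectionSpacePairKType_of_kMax_irreducible L (commute_tauLevel_archMaximalCompact L U₀) (U i) (hU i) hUirr (hUS.trans hSV)
  exact ⟨hcU, hUS, hUfd, fun k hk ψ hψ => hU i ⟨k, hk⟩ ψ hψ, fun ψ hψ => isChiSectionPair_of_mem (hSV (hUS hψ)), fun ψ hψ => continuous_of_mem_span_rightTranslation L hφc (hUS hψ),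
    fun ψ hψ => exists_bound_of_mem_span_kMaxTranslates L hφM (hUS hψ), hUS.trans hSV, ⟨hU i, hUirr⟩, W₀, hW₀K, hW₀fd, hirr₀, hle⟩

end Head

end Summit.HodgeConjecture.HodgeConjecture.R90.S8

end
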